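import Literature.NumberTheory.Automorphic.CDTTheorem712
import Literature.NumberTheory.Automorphic.BCDTTheoremB
import Literature.NumberTheory.GaloisRepresentations.ModPGaloisRep
import HarnessLib

/-!
# k3 · gen 20 · elaboration sanity of the helper-lemma STATEMENTS of `STUB-IDEAS-stub_switch-3.md`
(crux `FreyModularity`, stmt-ABC-11340; stub `stub_switch`).  No proofs: the proofs are the
farm-checked workfiles of the plan of record (lane A, `STUB_IDEAS_stub_switch_2g20_LaneA.md`).
This file only re-confirms on TODAY's tree that (i) the registered signature is `Iff.rfl`-equal to
`BCDT.CDT_three_five_switch`, (ii) the type of H6 (= hypothesis `h8c` of H5) elaborates, and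
(iii) the assembly H5 → H6 → stub is a two-token term.
-/

open Literature.NumberTheory.EllipticCurves Literature.NumberTheory.Automorphic
  Literature.NumberTheory.Automorphic.BCDT Literature.NumberTheory.GaloisRepresentations WeierstrassCurve Field

namespace StubSwitchK3G20

/-- The registered signature of `stub_switch` (skeleton sha `21576c53…`), verbatim. -/
def StubSwitchSig : Prop :=
  ∀ (W : WeierstrassCurve ℚ) [W.IsElliptic], ¬ 27 ∣ W.conductorNorm ℤ →
      (∀ ρ₃ : ModPGaloisRep ℚ (ZMod 3) 2, W.IsTorsionGaloisRep 3 ρ₃ →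
        ¬ ρ₃.IsAbsIrreducibleOverSqrt (-3)) →
      ∀ (ρ : ModPGaloisRep ℚ (ZMod 5) 2), W.IsTorsionGaloisRep 5 ρ → ρ.IsAbsIrreducibleOverSqrt 5 →
      ∃ (W' : WeierstrassCurve ℚ) (_ : W'.IsElliptic), W'.IsTorsionGaloisRep 5 ρ ∧
        ∃ ρ₃' : ModPGaloisRep ℚ (ZMod 3) 2, W'.IsTorsionGaloisRep 3 ρ₃' ∧
          ρ₃'.IsAbsIrreducibleOverSqrt (-3)

/-- (i) stub signature ↔ the named fact, definitionally. -/
theorem stubSwitchSig_iff : StubSwitchSig ↔ CDT_three_five_switch := Iff.rfl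

/-- H6's statement (= `ModThreeOrderEight.orderEightCriterion`; = hypothesis `h8c` of H5). -/
def OrderEightCriterion : Prop :=
  ∀ (ρ : ModPGaloisRep ℚ (ZMod 3) 2), (∀ σ : absoluteGaloisGroup ℚ,
      Matrix.GeneralLinearGroup.det (ρ σ) = modPCyclotomicCharacterZMod ℚ 3 σ) →
      ∀ (σ₀ : absoluteGaloisGroup ℚ), orderOf (ρ σ₀) = 8 → ρ.IsAbsIrreducibleOverSqrt (-3)

/-- H5's statement shape (= `CDTThreeFiveSwitch.Road.CDT_three_five_switch_of_orderEightCriterion`). -/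
def RoadStatement : Prop := OrderEightCriterion → CDT_three_five_switch

/-- (iii) assembly: H5, H6 ⇒ H7 (the fact) ⇒ H8 (the stub, verbatim signature). -/
theorem stub_of_road_of_criterion (h5 : RoadStatement) (h6 : OrderEightCriterion) : StubSwitchSig :=
  stubSwitchSig_iff.mpr (h5 h6)

/-- Degenerate-witness check (FAMILY 3, minimal counterexample to VACUITY): the `ρ̄₃`-premise is what
excludes the trivial witness `W' := W` — any witness must carry an abs. irreducible `ρ̄₃'`, which the
premise denies to `W` itself. Recorded as the one-line consequence it is. -/
theorem witness_ne_self_of_premise (W W' : WeierstrassCurve ℚ)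
    (h3 : ∀ ρ₃ : ModPGaloisRep ℚ (ZMod 3) 2, W.IsTorsionGaloisRep 3 ρ₃ → ¬ ρ₃.IsAbsIrreducibleOverSqrt (-3))
    (ρ₃' : ModPGaloisRep ℚ (ZMod 3) 2) (hW' : W'.IsTorsionGaloisRep 3 ρ₃')
    (hirr : ρ₃'.IsAbsIrreducibleOverSqrt (-3)) : W' ≠ W := by
  rintro rfl
  exact h3 ρ₃' hW' hirr

end StubSwitchK3G20
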